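import Mathlib.Data.ZMod.Basic
import Literature.Computability.Complexity.WalshHadamardDecoding
import Literature.Computability.Complexity.QuadEqTests
import HarnessLib

/-!
# The Hadamard-based PCP for `QUADEQ` (Arora–Barak, Thm. 11.19, §11.5.2): completeness and soundness

The combinatorial content of Arora–Barak's proof of `NP ⊆ PCP(poly(n), 1)` (Thm. 11.19): the
Walsh–Hadamard verifier for systems of quadratic equations over `GF(2)` and the analysis of its three
steps (§11.5.2), on top of the tree's linearity test (`LinearityTest.lean`, Thm. 11.21), the unique and
local decoding of the Walsh–Hadamard code (`WalshHadamardDecoding.lean`) and the two random-subsum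
steps (`QuadEqTests.lean`).  What is *not* here is machine-level: the NP-completeness of `QUADEQ`
(Exercise 11.15) and the polynomial running time of the verifier; the statements below are about the
verifier as a function of (instance, proof, coins) and count accepting coin tuples exactly.

## The instance, the proof, the verifier

A `QUADEQ` instance in `n` variables with `m` equations is `A : Fin m → (Fin (n·n) → Bool)` (row `k`
of the `m × n²` matrix, indexed by pairs through `finProdFinEquiv`) and `b : Fin m → Bool`; `u`
satisfies it iff `Aₖ ⊙ (u ⊗ u) = bₖ` for all `k` (`Satisfies`, with `tensorVec u u = u ⊗ u`).  A proof
is a pair of tables `f : GF(2)ⁿ → GF(2)`, `g : GF(2)^{n²} → GF(2)`.  The verifier (`accepts`) uses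
the coin tuple `Coins n m` and accepts iff

* Step 1: `T₁ = 70` BLR tests `f(x + y) = f(x) + f(y)` and `T₁` BLR tests on `g` all pass;
* Step 2: `T₂ = 3` tensor tests pass: for random `r, r' ∈ GF(2)ⁿ` and a random decoding offset
  `Z ∈ GF(2)^{n²}`, `g(Z) + g(r ⊗ r' + Z) = f(r) f(r')` (the value of `g̃` at `r ⊗ r'` is obtained by
  local decoding, in the two-query form of `WalshHadamardDecoding.lean`; `f` is read directly at the
  uniformly distributed `r`, `r'` — in print all values are obtained by local decoding, reading `f`
  at a uniform point is the degenerate case and has the same union-bound analysis);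
* Step 3: `T₃ = 2` random-equation tests pass: for a random subset `s` of the equations and a random
  offset `Z`, `g(Z) + g(∑_{k ∈ s} Aₖ + Z) = ∑_{k ∈ s} bₖ`.

(`6T₁ + 4T₂ + 2T₃ = 436` queries, `T₁(2n + 2n²) + T₂(2n + n²) + T₃(m + n²)` coins.)  The constants
differ from the printed ones ("0.999-linearity test", "ten times", final error `0.8` then repetition):
they are chosen so that one round already has soundness error `1/2`, with `δ = 1/100`:
`(1 - δ)^{70} ≤ 1/2`, `(3/4 + 4δ)³ ≤ 1/2`, `(1/2 + 2δ)² ≤ 1/2`.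

## Results

* `accepts_honest` (**completeness**): if `u` satisfies the instance then the honest proof
  `f = (u ⊙ ·)`, `g = (u ⊗ u ⊙ ·)` is accepted on every coin tuple;
* `two_mul_card_accepts_le` (**soundness**): if the instance is unsatisfiable then every proof `(f, g)`
  is accepted on at most half of the coin tuples.  Cases as in print: (A) `f` or `g` is not
  `(1 - δ)`-close to a linear function — Step 1 (Thm. 11.21, contrapositive, `T₁` independent trials);
  (B1) `f ≈ (u ⊙ ·)`, `g ≈ (w ⊙ ·)` with `w ≠ u ⊗ u` — Step 2 (random subsum twice,
  `BLR.four_mul_card_tensorTest_reject_ge`, plus the union bound over two direct reads of `f` and one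
  local decoding of `g`); (B2) `w = u ⊗ u`, so `u` violates some equation — Step 3
  (`BLR.two_mul_card_subsetSum_quadEq` plus one local decoding).

The `GF(2)` bookkeeping (`toZ : Bool → ZMod 2`, `toZ_dot`) turns the tree's counting definition of
`BLR.dot` into a `ZMod 2` sum, in which the bilinear identities `w ⊙ (r ⊗ r') = r W r'`
(`dot_tensorVec`) and `w ⊙ ∑_{k∈s} Aₖ = ∑_{k∈s} w ⊙ Aₖ` (`dot_subsetSum`) are re-bracketings.

## References

* S. Arora, B. Barak, *Computational Complexity: A Modern Approach*, CUP 2009, Thm. 11.19 and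
  §11.5.2 (the PCP verifier for `QUADEQ`, Steps 1–3), §11.5.1 (Walsh–Hadamard code).
-/

noncomputable section

namespace Literature.Computability.Complexity

open Finset Literature.Computability.Complexity.LowDegree

namespace BLR

variable {n m N : ℕ}

/-! ### `GF(2)` bookkeeping: bits as elements of `ZMod 2` -/

/-- A bit as an element of `GF(2) = ZMod 2`. [folklore] -/
def toZ (b : Bool) : ZMod 2 := if b then 1 else 0

/-- `toZ` is injective. [folklore] -/
theorem toZ_injective : Function.Injective toZ := by
  intro a b h
  cases a <;> cases b <;> first | rfl | (exfalso; revert h; decide)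

/-- Addition in `GF(2)` is `xor`. [folklore] -/
theorem toZ_xor (a b : Bool) : toZ (xor a b) = toZ a + toZ b := by
  cases a <;> cases b <;> decide

/-- Multiplication in `GF(2)` is `and`. [folklore] -/
theorem toZ_and (a b : Bool) : toZ (a && b) = toZ a * toZ b := by
  cases a <;> cases b <;> decide

/-- The parity bit of a number is its residue mod `2`. [folklore] -/
theorem toZ_decide_odd (c : ℕ) : toZ (decide (Odd c)) = (c : ZMod 2) := by
  by_cases h : Odd c
  · rw [decide_eq_true h, toZ, if_pos rfl, ZMod.natCast_eq_one_iff_odd.2 h]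
  · rw [decide_eq_false h, toZ, if_neg Bool.false_ne_true, ZMod.natCast_eq_zero_iff_even.2 (Nat.not_odd_iff_even.1 h)]

/-- **The inner product as a `GF(2)` sum**: `u ⊙ x = ∑ᵢ uᵢ xᵢ` in `ZMod 2`. [cite: AroraBarakCC2009, §11.5.1] -/
theorem toZ_dot {ι : ℕ} (u x : Fin ι → Bool) : toZ (dot u x) = ∑ i, toZ (u i) * toZ (x i) := by
  rw [dot, toZ_decide_odd]
  have : ∀ i : Fin ι, toZ (u i) * toZ (x i) = if u i = true ∧ x i = true then 1 else 0 := fun i => by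
    cases u i <;> cases x i <;> decide
  rw [sum_congr rfl fun i _ => this i, sum_boole]

/-! ### Vectors of `GF(2)^{n²}`: tensors, matrices, subset sums -/

/-- The tensor product `r ⊗ r' ∈ GF(2)^{n²}`, `(r ⊗ r')_{(i,j)} = rᵢ r'ⱼ` (pairs coded by `finProdFinEquiv`).
[cite: AroraBarakCC2009, §11.5.2 (footnote 4)] -/
def tensorVec (r r' : Fin n → Bool) : Fin (n * n) → Bool :=
  fun k => r (finProdFinEquiv.symm k).1 && r' (finProdFinEquiv.symm k).2

/-- The `n × n` matrix with the entries of `w ∈ GF(2)^{n²}`. [cite: AroraBarakCC2009, §11.5.2 (Step 2, "let W be an n × n matrix with the same entries as w")] -/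
def mat (w : Fin (n * n) → Bool) : Fin n → Fin n → Bool := fun i j => w (finProdFinEquiv (i, j))

/-- `mat` is injective (every index of `Fin (n·n)` is a pair). [folklore] -/
theorem mat_injective : Function.Injective (mat (n := n)) := by
  intro w w' h
  funext k
  have := congrFun (congrFun h (finProdFinEquiv.symm k).1) (finProdFinEquiv.symm k).2
  simp only [mat, Prod.mk.eta, Equiv.apply_symm_apply] at this
  exact this

/-- The matrix of `u ⊗ u` is `(uᵢ uⱼ)`. [folklore] -/
theorem mat_tensorVec (u u' : Fin n → Bool) : mat (tensorVec u u') = fun i j => u i && u' j := by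
  funext i j
  simp [mat, tensorVec]

/-- **`g(r ⊗ r') = r W r'`**: for the linear function `g = (w ⊙ ·)`, `w ⊙ (r ⊗ r') = ∑ᵢⱼ Wᵢⱼ rᵢ r'ⱼ = (rW) ⊙ r'`.
[cite: AroraBarakCC2009, §11.5.2 (Step 2, "g(r ⊗ r') = w ⊙ (r ⊗ r') = rWr'")] -/
theorem dot_tensorVec (w : Fin (n * n) → Bool) (r r' : Fin n → Bool) :
    dot w (tensorVec r r') = bilin (mat w) r r' := by
  apply toZ_injective
  rw [bilin, toZ_dot, toZ_dot]
  calc ∑ k, toZ (w k) * toZ (tensorVec r r' k)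
      = ∑ p : Fin n × Fin n, toZ (mat w p.1 p.2) * (toZ (r p.1) * toZ (r' p.2)) := by
        refine Fintype.sum_equiv finProdFinEquiv.symm _ _ fun k => ?_
        simp only [mat, tensorVec]
        rw [Prod.mk.eta, Equiv.apply_symm_apply, toZ_and]
    _ = ∑ j, (∑ i, toZ (mat w i j) * toZ (r i)) * toZ (r' j) := by
        rw [Fintype.sum_prod_type_right]
        refine sum_congr rfl fun j _ => ?_
        rw [sum_mul]
        exact sum_congr rfl fun i _ => by ring
    _ = ∑ j, toZ (rowMul (mat w) r j) * toZ (r' j) := by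
        refine sum_congr rfl fun j _ => ?_
        rw [rowMul, toZ_dot]

/-- The `GF(2)`-sum of the rows `Aₖ`, `k ∈ s`: `(∑_{k ∈ s} Aₖ)_idx = s ⊙ (A · idx)`.
[cite: AroraBarakCC2009, §11.5.2 (Step 3, "takes a random subset of the equations and computes their sum mod 2")] -/
def subsetSum (s : Fin m → Bool) (A : Fin m → Fin N → Bool) : Fin N → Bool := fun idx => dot s fun k => A k idx

/-- **Linearity over subset sums**: `w ⊙ ∑_{k ∈ s} Aₖ = ∑_{k ∈ s} (w ⊙ Aₖ)`. [cite: AroraBarakCC2009, §11.5.2 (Step 3)] -/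
theorem dot_subsetSum (w : Fin N → Bool) (s : Fin m → Bool) (A : Fin m → Fin N → Bool) :
    dot w (subsetSum s A) = dot s fun k => dot w (A k) := by
  apply toZ_injective
  rw [toZ_dot, toZ_dot]
  simp_rw [subsetSum, toZ_dot, mul_sum]
  rw [sum_comm]
  exact sum_congr rfl fun k _ => sum_congr rfl fun idx _ => by ring

/-- The sum over `GF(2)` distributes over `xor` of vectors: `s ⊙ (a + c) = s ⊙ a + s ⊙ c`. [folklore] -/
theorem dot_xor_right (s a c : Fin m → Bool) : dot s (fun k => xor (a k) (c k)) = xor (dot s a) (dot s c) :=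
  dot_xorVec s a c

/-! ### The instance and the verifier -/

/-- `u` satisfies the `QUADEQ` instance `(A, b)`: `∑ᵢⱼ A_{k,(i,j)} uᵢ uⱼ = bₖ` for every `k`, i.e.
`Aₖ ⊙ (u ⊗ u) = bₖ`. [cite: AroraBarakCC2009, §11.5.2 (eq. (11.4); "AU = b and U = u ⊗ u")] -/
def Satisfies (A : Fin m → Fin (n * n) → Bool) (b : Fin m → Bool) (u : Fin n → Bool) : Prop :=
  ∀ k, dot (A k) (tensorVec u u) = b k

/-- Number of BLR trials per table (Step 1). [folklore] -/
def T₁ : ℕ := 70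
/-- Number of tensor-test trials (Step 2). [folklore] -/
def T₂ : ℕ := 3
/-- Number of random-equation trials (Step 3). [folklore] -/
def T₃ : ℕ := 2

/-- The verifier's coin tuple: `T₁` BLR pairs for `f`, `T₁` BLR pairs for `g`, `T₂` triples `(r, r', Z)` for
the tensor test, `T₃` pairs `(s, Z)` for the random-equation test. [cite: AroraBarakCC2009, §11.5.2] -/
abbrev Coins (n m : ℕ) : Type :=
  (Fin T₁ → (Fin n → Bool) × (Fin n → Bool)) × (Fin T₁ → (Fin (n * n) → Bool) × (Fin (n * n) → Bool)) ×
    (Fin T₂ → (Fin n → Bool) × (Fin n → Bool) × (Fin (n * n) → Bool)) × (Fin T₃ → (Fin m → Bool) × (Fin (n * n) → Bool))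

/-- One BLR trial on the table `h` passes on the pair `(x, y)`: `h(x + y) = h(x) + h(y)`.
[cite: AroraBarakCC2009, §11.5.2 (Step 1)] -/
def blrPass {ι : ℕ} (h : (Fin ι → Bool) → Bool) (p : (Fin ι → Bool) × (Fin ι → Bool)) : Bool :=
  decide (h (xorVec p.1 p.2) = xor (h p.1) (h p.2))

/-- One tensor trial passes on `(r, r', Z)`: the locally decoded value `g(Z) + g(r ⊗ r' + Z)` of `g` at
`r ⊗ r'` equals `f(r) f(r')`. [cite: AroraBarakCC2009, §11.5.2 (Step 2)] -/
def tensorPass (f : (Fin n → Bool) → Bool) (g : (Fin (n * n) → Bool) → Bool)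
    (c : (Fin n → Bool) × (Fin n → Bool) × (Fin (n * n) → Bool)) : Bool :=
  decide (xor (g c.2.2) (g (xorVec (tensorVec c.1 c.2.1) c.2.2)) = (f c.1 && f c.2.1))

/-- One random-equation trial passes on `(s, Z)`: the locally decoded value of `g` at `∑_{k ∈ s} Aₖ`
equals `∑_{k ∈ s} bₖ`. [cite: AroraBarakCC2009, §11.5.2 (Step 3)] -/
def eqPass (A : Fin m → Fin (n * n) → Bool) (b : Fin m → Bool) (g : (Fin (n * n) → Bool) → Bool)
    (c : (Fin m → Bool) × (Fin (n * n) → Bool)) : Bool :=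
  decide (xor (g c.2) (g (xorVec (subsetSum c.1 A) c.2)) = dot c.1 b)

/-- **The Walsh–Hadamard verifier for `QUADEQ`** accepts the proof `(f, g)` on the coins `c` iff all
`T₁ + T₁` BLR trials, all `T₂` tensor trials and all `T₃` random-equation trials pass.
[cite: AroraBarakCC2009, §11.5.2 (the PCP verifier)] -/
def accepts (A : Fin m → Fin (n * n) → Bool) (b : Fin m → Bool) (f : (Fin n → Bool) → Bool)
    (g : (Fin (n * n) → Bool) → Bool) (c : Coins n m) : Bool :=
  decide ((∀ i, blrPass f (c.1 i) = true) ∧ (∀ i, blrPass g (c.2.1 i) = true) ∧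
    (∀ i, tensorPass f g (c.2.2.1 i) = true) ∧ (∀ i, eqPass A b g (c.2.2.2 i) = true))

/-! ### Completeness -/

/-- A linear table passes every BLR trial. [cite: AroraBarakCC2009, §11.5.1] -/
theorem blrPass_dot {ι : ℕ} (u : Fin ι → Bool) (p : (Fin ι → Bool) × (Fin ι → Bool)) : blrPass (dot u) p = true :=
  decide_eq_true (dot_xorVec u p.1 p.2)

/-- Local decoding of a linear table is always correct: `g(Z) + g(Z + t) = g(t)`. [cite: AroraBarakCC2009, §11.5.1] -/
theorem decode_dot {ι : ℕ} (w t Z : Fin ι → Bool) : xor (dot w Z) (dot w (xorVec t Z)) = dot w t := by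
  rw [dot_xorVec]
  cases dot w Z <;> cases dot w t <;> rfl

/-- **Completeness** (Arora–Barak, §11.5.2: "V accepts proofs of this form with probability one"): if `u`
satisfies `(A, b)` then the honest proof `f = WH(u) = (u ⊙ ·)`, `g = WH(u ⊗ u)` is accepted on every
coin tuple. [cite: AroraBarakCC2009, Thm. 11.19 (proof, completeness)] -/
theorem accepts_honest {A : Fin m → Fin (n * n) → Bool} {b : Fin m → Bool} {u : Fin n → Bool}
    (hu : Satisfies A b u) (c : Coins n m) : accepts A b (dot u) (dot (tensorVec u u)) c = true := by
  refine decide_eq_true ⟨fun i => blrPass_dot u _, fun i => blrPass_dot _ _, fun i => decide_eq_true ?_,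
    fun i => decide_eq_true ?_⟩
  · -- Step 2: `g(r ⊗ r') = r U r' = (u ⊙ r)(u ⊙ r')`
    rw [decode_dot, dot_tensorVec, mat_tensorVec]
    exact bilin_tensorSelf u _ _
  · -- Step 3: `g(∑ Aₖ) = ∑ g(Aₖ) = ∑ bₖ`
    rw [decode_dot, dot_subsetSum]
    congr 1
    funext k
    rw [dot_comm]
    exact hu k

/-! ### Counting coin tuples -/

/-- `|GF(2)^ι| = 2^ι`. [folklore] -/
theorem card_vec (ι : ℕ) : Fintype.card (Fin ι → Bool) = 2 ^ ι := by
  rw [Fintype.card_fun, Fintype.card_bool, Fintype.card_fin]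

/-- **Independent trials**: the `T`-tuples all of whose entries pass number `#{pass}^T`. [folklore] -/
theorem card_filter_pi_forall {T : ℕ} {α : Type} [Fintype α] [DecidableEq α] (P : α → Bool) :
    (univ.filter fun c : Fin T → α => ∀ i, P (c i) = true).card = (univ.filter fun a => P a = true).card ^ T := by
  have : (univ.filter fun c : Fin T → α => ∀ i, P (c i) = true) = Fintype.piFinset fun _ => univ.filter fun a => P a = true := by
    ext c
    simp [Fintype.mem_piFinset]
  rw [this, Fintype.card_piFinset, prod_const, card_univ, Fintype.card_fin]

/-- Either `h` is `ρ`-close to a linear function or it passes fewer than `ρ 4^ι` BLR pairs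
(Thm. 11.21, contrapositive). [cite: AroraBarakCC2009, Thm. 11.21] -/
theorem isClose_or_passCount_lt {ι : ℕ} (h : (Fin ι → Bool) → Bool) (ρ : ℝ) :
    (∃ u, IsClose ρ h (dot u)) ∨ (passCount h : ℝ) < ρ * 4 ^ ι := by
  by_cases hlt : (passCount h : ℝ) < ρ * 4 ^ ι
  · exact Or.inr hlt
  · exact Or.inl (linearityTest h (not_lt.1 hlt))

/-- The closeness parameter `δ = 1/100` of the analysis. [folklore] -/
def δ₀ : ℝ := 1 / 100

/-- **Step 1 catches a table far from linear**: if `h` is not `(1 - δ)`-close to any linear function then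
at most half of the `T₁`-tuples of BLR pairs all pass (`(1 - δ)^{T₁} ≤ 1/2`).
[cite: AroraBarakCC2009, §11.5.2 (Step 1)] -/
theorem two_mul_card_blrTrials_le {ι : ℕ} (h : (Fin ι → Bool) → Bool) (hfar : ∀ u, ¬ IsClose (1 - δ₀) h (dot u)) :
    2 * (univ.filter fun c : Fin T₁ → (Fin ι → Bool) × (Fin ι → Bool) => ∀ i, blrPass h (c i) = true).card ≤
      Fintype.card (Fin T₁ → (Fin ι → Bool) × (Fin ι → Bool)) := by
  classical
  have hpc : (passCount h : ℝ) ≤ (1 - δ₀) * 4 ^ ι := by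
    rcases isClose_or_passCount_lt h (1 - δ₀) with ⟨u, hu⟩ | hlt
    · exact absurd hu (hfar u)
    · exact hlt.le
  have hpass : (univ.filter fun p : (Fin ι → Bool) × (Fin ι → Bool) => blrPass h p = true).card = passCount h := by
    unfold passCount blrPass
    congr 1
    ext p
    simp
  rw [card_filter_pi_forall, Fintype.card_fun, Fintype.card_fin, Fintype.card_prod, card_vec, hpass]
  have h4 : (2 : ℕ) ^ ι * 2 ^ ι = 4 ^ ι := by rw [← mul_pow]; norm_num
  rw [h4]
  have key : 2 * (passCount h : ℝ) ^ T₁ ≤ (4 ^ ι : ℝ) ^ T₁ := by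
    calc 2 * (passCount h : ℝ) ^ T₁ ≤ 2 * ((1 - δ₀) * 4 ^ ι) ^ T₁ :=
          mul_le_mul_of_nonneg_left (pow_le_pow_left₀ (by positivity) hpc _) (by norm_num)
      _ = (2 * (1 - δ₀) ^ T₁) * (4 ^ ι) ^ T₁ := by rw [mul_pow]; ring
      _ ≤ 1 * (4 ^ ι) ^ T₁ := mul_le_mul_of_nonneg_right (by rw [δ₀, T₁]; norm_num) (by positivity)
      _ = (4 ^ ι : ℝ) ^ T₁ := one_mul _
  exact_mod_cast key

/-- The points misread by a `(1 - δ)`-close table are at most `δ 2^ι`. [folklore] -/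
theorem card_ne_dot_le {ι : ℕ} {h : (Fin ι → Bool) → Bool} {u : Fin ι → Bool} {δ : ℝ} (hclose : IsClose (1 - δ) h (dot u)) :
    ((univ.filter fun x => h x ≠ dot u x).card : ℝ) ≤ δ * 2 ^ ι := by
  have hcard := Finset.card_filter_add_card_filter_not (s := (univ : Finset (Fin ι → Bool))) (fun x => h x = dot u x)
  rw [card_univ, card_vec] at hcard
  have h' : ((univ.filter fun x => h x = dot u x).card : ℝ) + (univ.filter fun x => ¬ h x = dot u x).card = 2 ^ ι := by
    exact_mod_cast hcard
  unfold IsClose agree at hclose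
  simp only [ne_eq]
  linarith

/-- The same in the form `2^ι - #agreements ≤ δ 2^ι`. [folklore] -/
theorem two_pow_sub_agree_le {ι : ℕ} {h : (Fin ι → Bool) → Bool} {u : Fin ι → Bool} {δ : ℝ} (hclose : IsClose (1 - δ) h (dot u)) :
    ((2 ^ ι - agree h (dot u) : ℕ) : ℝ) ≤ δ * 2 ^ ι := by
  have hA : agree h (dot u) ≤ 2 ^ ι := by
    unfold agree
    exact (card_le_univ _).trans (le_of_eq (card_vec ι))
  push_cast [Nat.cast_sub hA]
  unfold IsClose at hclose
  linarith

/-! ### Step 2: soundness of one tensor trial -/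

/-- **One tensor trial passes with probability at most `3/4 + 4δ`** when `f ≈ (u ⊙ ·)`, `g ≈ (w ⊙ ·)`
are `(1 - δ)`-close and `w ≠ u ⊗ u`: the passing triples `(r, r', Z)` lie in the union of
`{f(r) ≠ u ⊙ r}`, `{f(r') ≠ u ⊙ r'}` (`δ` each), `{decoding of g at r ⊗ r' fails}` (`2δ`) and
`{w ⊙ (r ⊗ r') = (u ⊙ r)(u ⊙ r')}` (`3/4`, the tensor test). [cite: AroraBarakCC2009, §11.5.2 (Step 2)] -/
theorem card_tensorPass_le {f : (Fin n → Bool) → Bool} {g : (Fin (n * n) → Bool) → Bool} {u : Fin n → Bool}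
    {w : Fin (n * n) → Bool} {δ : ℝ} (hf : IsClose (1 - δ) f (dot u)) (hg : IsClose (1 - δ) g (dot w))
    (hw : w ≠ tensorVec u u) :
    ((univ.filter fun q => tensorPass f g q = true).card : ℝ) ≤ (3 / 4 + 4 * δ) * (2 ^ n * (2 ^ n * 2 ^ (n * n))) := by
  classical
  -- the four events
  set E1 : Finset ((Fin n → Bool) × (Fin n → Bool) × (Fin (n * n) → Bool)) := univ.filter fun q => f q.1 ≠ dot u q.1
  set E2 : Finset ((Fin n → Bool) × (Fin n → Bool) × (Fin (n * n) → Bool)) := univ.filter fun q => f q.2.1 ≠ dot u q.2.1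
  set E3 : Finset ((Fin n → Bool) × (Fin n → Bool) × (Fin (n * n) → Bool)) :=
    univ.filter fun q => xor (g q.2.2) (g (xorVec (tensorVec q.1 q.2.1) q.2.2)) ≠ dot w (tensorVec q.1 q.2.1)
  set E4 : Finset ((Fin n → Bool) × (Fin n → Bool) × (Fin (n * n) → Bool)) :=
    univ.filter fun q => dot w (tensorVec q.1 q.2.1) = (dot u q.1 && dot u q.2.1)
  have hsub : (univ.filter fun q => tensorPass f g q = true) ⊆ E1 ∪ E2 ∪ E3 ∪ E4 := by
    intro q hq
    simp only [mem_filter, mem_univ, true_and, tensorPass, decide_eq_true_eq] at hq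
    simp only [E1, E2, E3, E4, mem_union, mem_filter, mem_univ, true_and]
    by_contra hno
    push Not at hno
    obtain ⟨⟨⟨h1, h2⟩, h3⟩, h4⟩ := hno
    exact h4 (by rw [← h3, hq, h1, h2])
  -- their sizes
  have hE1 : (E1.card : ℝ) ≤ δ * (2 ^ n * (2 ^ n * 2 ^ (n * n))) := by
    have : E1 = (univ.filter fun r : Fin n → Bool => f r ≠ dot u r) ×ˢ (univ : Finset ((Fin n → Bool) × (Fin (n * n) → Bool))) := by
      ext q; simp [E1]
    rw [this, card_product, card_univ, Fintype.card_prod, card_vec, card_vec]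
    push_cast
    have := card_ne_dot_le hf
    nlinarith [show (0 : ℝ) ≤ 2 ^ n * 2 ^ (n * n) by positivity]
  have hE2 : (E2.card : ℝ) ≤ δ * (2 ^ n * (2 ^ n * 2 ^ (n * n))) := by
    have : E2 = (univ : Finset (Fin n → Bool)) ×ˢ ((univ.filter fun r : Fin n → Bool => f r ≠ dot u r) ×ˢ
        (univ : Finset (Fin (n * n) → Bool))) := by
      ext q; simp [E2]
    rw [this, card_product, card_product, card_univ, card_univ, card_vec, card_vec]
    push_cast
    have := card_ne_dot_le hf
    nlinarith [show (0 : ℝ) ≤ 2 ^ n * 2 ^ (n * n) by positivity, show (0 : ℝ) ≤ 2 ^ n by positivity]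
  have hE3 : (E3.card : ℝ) ≤ 2 * δ * (2 ^ n * (2 ^ n * 2 ^ (n * n))) := by
    have hsum : E3.card = ∑ r : Fin n → Bool, ∑ r' : Fin n → Bool,
        (univ.filter fun Z : Fin (n * n) → Bool => xor (g Z) (g (xorVec (tensorVec r r') Z)) ≠ dot w (tensorVec r r')).card := by
      rw [card_filter, Fintype.sum_prod_type]
      refine sum_congr rfl fun r _ => ?_
      rw [Fintype.sum_prod_type]
      refine sum_congr rfl fun r' _ => ?_
      rw [card_filter]
    have hdec : ∀ r r' : Fin n → Bool,
        ((univ.filter fun Z : Fin (n * n) → Bool => xor (g Z) (g (xorVec (tensorVec r r') Z)) ≠ dot w (tensorVec r r')).card : ℝ) ≤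
          2 * δ * 2 ^ (n * n) := fun r r' => by
      have h1 := card_localDecode_wrong_le g w (tensorVec r r')
      have h2 := two_pow_sub_agree_le hg
      have h1' : ((univ.filter fun Z : Fin (n * n) → Bool => xor (g Z) (g (xorVec (tensorVec r r') Z)) ≠ dot w (tensorVec r r')).card : ℝ) ≤
          2 * ((2 ^ (n * n) - agree g (dot w) : ℕ) : ℝ) := by exact_mod_cast h1
      linarith
    rw [hsum]
    push_cast
    calc ∑ r : Fin n → Bool, ∑ r' : Fin n → Bool,
          (((univ.filter fun Z : Fin (n * n) → Bool => xor (g Z) (g (xorVec (tensorVec r r') Z)) ≠ dot w (tensorVec r r')).card : ℕ) : ℝ)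
        ≤ ∑ r : Fin n → Bool, ∑ r' : Fin n → Bool, 2 * δ * 2 ^ (n * n) := sum_le_sum fun r _ => sum_le_sum fun r' _ => hdec r r'
      _ = 2 * δ * (2 ^ n * (2 ^ n * 2 ^ (n * n))) := by
        rw [sum_const, sum_const, card_univ, card_vec, nsmul_eq_mul, nsmul_eq_mul]
        push_cast
        ring
  have hE4 : (E4.card : ℝ) ≤ 3 / 4 * (2 ^ n * (2 ^ n * 2 ^ (n * n))) := by
    have hW : mat w ≠ tensorSelf u := fun hWU => hw (mat_injective (by rw [hWU, mat_tensorVec]; rfl))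
    have hrej := four_mul_card_tensorTest_reject_ge hW
    -- `E4` in matrix form, and its complement: the rejecting pairs times the offsets
    have hE4eq : E4 = univ.filter fun q : (Fin n → Bool) × (Fin n → Bool) × (Fin (n * n) → Bool) =>
        bilin (mat w) q.1 q.2.1 = bilin (tensorSelf u) q.1 q.2.1 := by
      refine filter_congr fun q _ => ?_
      rw [dot_tensorVec, bilin_tensorSelf]
    have hrej3 : (univ.filter fun q : (Fin n → Bool) × (Fin n → Bool) × (Fin (n * n) → Bool) =>
        ¬ bilin (mat w) q.1 q.2.1 = bilin (tensorSelf u) q.1 q.2.1).card =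
          (univ.filter fun p : (Fin n → Bool) × (Fin n → Bool) => bilin (mat w) p.1 p.2 ≠ bilin (tensorSelf u) p.1 p.2).card *
            2 ^ (n * n) := by
      rw [← card_vec (n * n), ← card_univ, ← card_product]
      refine card_equiv (Equiv.prodAssoc _ _ _).symm fun q => ?_
      simp
    have hcard := Finset.card_filter_add_card_filter_not
      (s := (univ : Finset ((Fin n → Bool) × (Fin n → Bool) × (Fin (n * n) → Bool))))
      (fun q => bilin (mat w) q.1 q.2.1 = bilin (tensorSelf u) q.1 q.2.1)
    rw [card_univ, Fintype.card_prod, Fintype.card_prod, card_vec, card_vec, ← hE4eq, hrej3] at hcard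
    have hcardR : (E4.card : ℝ) + ((univ.filter fun p : (Fin n → Bool) × (Fin n → Bool) =>
        bilin (mat w) p.1 p.2 ≠ bilin (tensorSelf u) p.1 p.2).card : ℝ) * 2 ^ (n * n) = 2 ^ n * (2 ^ n * 2 ^ (n * n)) := by
      exact_mod_cast hcard
    have hrejR : (4 : ℝ) ^ n ≤ 4 * ((univ.filter fun p : (Fin n → Bool) × (Fin n → Bool) =>
        bilin (mat w) p.1 p.2 ≠ bilin (tensorSelf u) p.1 p.2).card : ℝ) := by exact_mod_cast hrej
    have h4R : (4 : ℝ) ^ n = 2 ^ n * 2 ^ n := by rw [← mul_pow]; norm_num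
    rw [h4R] at hrejR
    nlinarith [show (0 : ℝ) ≤ 2 ^ (n * n) by positivity]
  -- union bound
  have h123 : (E1 ∪ E2 ∪ E3).card ≤ E1.card + E2.card + E3.card :=
    (card_union_le (E1 ∪ E2) E3).trans (Nat.add_le_add_right (card_union_le E1 E2) _)
  have h1234 : (E1 ∪ E2 ∪ E3 ∪ E4).card ≤ E1.card + E2.card + E3.card + E4.card :=
    (card_union_le (E1 ∪ E2 ∪ E3) E4).trans (Nat.add_le_add_right h123 _)
  have hunion : ((univ.filter fun q => tensorPass f g q = true).card : ℝ) ≤ E1.card + E2.card + E3.card + E4.card := by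
    exact_mod_cast (card_le_card hsub).trans h1234
  linarith

/-! ### Step 3: soundness of one random-equation trial -/

/-- **One random-equation trial passes with probability at most `1/2 + 2δ`** when `g ≈ (w ⊙ ·)` is
`(1 - δ)`-close with `w = u ⊗ u` for an assignment `u` violating some equation: the passing pairs
`(s, Z)` lie in the union of `{decoding of g at ∑_{k∈s} Aₖ fails}` (`2δ`) and
`{∑_{k∈s} (Aₖ ⊙ w + bₖ) = 0}` (exactly `1/2`, random subsum). [cite: AroraBarakCC2009, §11.5.2 (Step 3)] -/
theorem card_eqPass_le {A : Fin m → Fin (n * n) → Bool} {b : Fin m → Bool} {g : (Fin (n * n) → Bool) → Bool}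
    {w : Fin (n * n) → Bool} {δ : ℝ} (hg : IsClose (1 - δ) g (dot w)) (hviol : ∃ k, dot (A k) w ≠ b k) :
    ((univ.filter fun q => eqPass A b g q = true).card : ℝ) ≤ (1 / 2 + 2 * δ) * (2 ^ m * 2 ^ (n * n)) := by
  classical
  set e : Fin m → Bool := fun k => xor (dot w (A k)) (b k) with he_def
  have he : e ≠ fun _ => false := fun h0 => by
    obtain ⟨k, hk⟩ := hviol
    have := congrFun h0 k
    simp only [he_def] at this
    apply hk
    rw [dot_comm]
    revert this
    cases dot w (A k) <;> cases b k <;> simp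
  set E5 : Finset ((Fin m → Bool) × (Fin (n * n) → Bool)) :=
    univ.filter fun q => xor (g q.2) (g (xorVec (subsetSum q.1 A) q.2)) ≠ dot w (subsetSum q.1 A)
  set E6 : Finset ((Fin m → Bool) × (Fin (n * n) → Bool)) := univ.filter fun q => dot q.1 e = false
  have hsub : (univ.filter fun q => eqPass A b g q = true) ⊆ E5 ∪ E6 := by
    intro q hq
    simp only [mem_filter, mem_univ, true_and, eqPass, decide_eq_true_eq] at hq
    simp only [E5, E6, mem_union, mem_filter, mem_univ, true_and]
    by_contra hno
    push Not at hno
    obtain ⟨h5, h6⟩ := hno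
    rw [dot_subsetSum] at h5
    have : dot q.1 e = xor (dot q.1 fun k => dot w (A k)) (dot q.1 b) := dot_xor_right q.1 _ _
    rw [← h5, hq, Bool.xor_self] at this
    exact h6 this
  have hE5 : (E5.card : ℝ) ≤ 2 * δ * (2 ^ m * 2 ^ (n * n)) := by
    have hsum : E5.card = ∑ s : Fin m → Bool,
        (univ.filter fun Z : Fin (n * n) → Bool => xor (g Z) (g (xorVec (subsetSum s A) Z)) ≠ dot w (subsetSum s A)).card := by
      rw [card_filter, Fintype.sum_prod_type]
      refine sum_congr rfl fun s _ => ?_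
      rw [card_filter]
    have hdec : ∀ s : Fin m → Bool,
        ((univ.filter fun Z : Fin (n * n) → Bool => xor (g Z) (g (xorVec (subsetSum s A) Z)) ≠ dot w (subsetSum s A)).card : ℝ) ≤
          2 * δ * 2 ^ (n * n) := fun s => by
      have h1 := card_localDecode_wrong_le g w (subsetSum s A)
      have h2 := two_pow_sub_agree_le hg
      have h1' : ((univ.filter fun Z : Fin (n * n) → Bool => xor (g Z) (g (xorVec (subsetSum s A) Z)) ≠ dot w (subsetSum s A)).card : ℝ) ≤
          2 * ((2 ^ (n * n) - agree g (dot w) : ℕ) : ℝ) := by exact_mod_cast h1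
      linarith
    rw [hsum]
    push_cast
    calc ∑ s : Fin m → Bool,
          (((univ.filter fun Z : Fin (n * n) → Bool => xor (g Z) (g (xorVec (subsetSum s A) Z)) ≠ dot w (subsetSum s A)).card : ℕ) : ℝ)
        ≤ ∑ s : Fin m → Bool, 2 * δ * 2 ^ (n * n) := sum_le_sum fun s _ => hdec s
      _ = 2 * δ * (2 ^ m * 2 ^ (n * n)) := by
        rw [sum_const, card_univ, card_vec, nsmul_eq_mul]
        push_cast
        ring
  have hE6 : (E6.card : ℝ) = 1 / 2 * (2 ^ m * 2 ^ (n * n)) := by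
    have hhalf := two_mul_card_subsetSum_violated he
    have hcard := Finset.card_filter_add_card_filter_not (s := (univ : Finset (Fin m → Bool))) (fun s => dot s e = true)
    rw [card_univ, card_vec] at hcard
    have hfalse : (univ.filter fun s : Fin m → Bool => dot s e = false).card = (univ.filter fun s : Fin m → Bool => ¬ dot s e = true).card := by
      congr 1; ext s; simp
    have hE6card : E6.card = (univ.filter fun s : Fin m → Bool => dot s e = false).card * 2 ^ (n * n) := by
      rw [card_filter, card_filter, Fintype.sum_prod_type, sum_mul]
      refine sum_congr rfl fun s _ => ?_
      show (∑ _Z : Fin (n * n) → Bool, if dot s e = false then (1 : ℕ) else 0) = (if dot s e = false then 1 else 0) * 2 ^ (n * n)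
      rw [sum_const, card_univ, card_vec, smul_eq_mul, Nat.mul_comm]
    have h2 : 2 * (univ.filter fun s : Fin m → Bool => dot s e = false).card = 2 ^ m := by omega
    have h2R : 2 * ((univ.filter fun s : Fin m → Bool => dot s e = false).card : ℝ) = 2 ^ m := by exact_mod_cast h2
    rw [hE6card]
    push_cast
    rw [show ((univ.filter fun s : Fin m → Bool => dot s e = false).card : ℝ) = 2 ^ m / 2 by linarith]
    ring
  have hunion : ((univ.filter fun q => eqPass A b g q = true).card : ℝ) ≤ E5.card + E6.card := by
    exact_mod_cast (card_le_card hsub).trans (card_union_le E5 E6)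
  linarith

/-! ### Soundness -/

/-- **Projection bounds** for a property of one of four independent coordinates implied by acceptance:
first coordinate. [folklore] -/
theorem card_filter_le_fst {α β γ η : Type} [Fintype α] [Fintype β] [Fintype γ] [Fintype η]
    (Acc : α × β × γ × η → Prop) [DecidablePred Acc] (P : α → Prop) [DecidablePred P] (h : ∀ p, Acc p → P p.1) :
    (univ.filter Acc).card ≤ (univ.filter P).card * (Fintype.card β * (Fintype.card γ * Fintype.card η)) := by
  calc (univ.filter Acc).card ≤ ((univ.filter P) ×ˢ (univ : Finset (β × γ × η))).card :=
        card_le_card fun p hp => mem_product.2 ⟨mem_filter.2 ⟨mem_univ _, h p (mem_filter.1 hp).2⟩, mem_univ _⟩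
    _ = _ := by rw [card_product, card_univ, Fintype.card_prod, Fintype.card_prod]

/-- Second coordinate. [folklore] -/
theorem card_filter_le_snd {α β γ η : Type} [Fintype α] [Fintype β] [Fintype γ] [Fintype η]
    (Acc : α × β × γ × η → Prop) [DecidablePred Acc] (P : β → Prop) [DecidablePred P] (h : ∀ p, Acc p → P p.2.1) :
    (univ.filter Acc).card ≤ Fintype.card α * ((univ.filter P).card * (Fintype.card γ * Fintype.card η)) := by
  calc (univ.filter Acc).card ≤ ((univ : Finset α) ×ˢ ((univ.filter P) ×ˢ (univ : Finset (γ × η)))).card :=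
        card_le_card fun p hp => mem_product.2 ⟨mem_univ _, mem_product.2
          ⟨mem_filter.2 ⟨mem_univ _, h p (mem_filter.1 hp).2⟩, mem_univ _⟩⟩
    _ = _ := by rw [card_product, card_product, card_univ, card_univ, Fintype.card_prod]

/-- Third coordinate. [folklore] -/
theorem card_filter_le_thd {α β γ η : Type} [Fintype α] [Fintype β] [Fintype γ] [Fintype η]
    (Acc : α × β × γ × η → Prop) [DecidablePred Acc] (P : γ → Prop) [DecidablePred P] (h : ∀ p, Acc p → P p.2.2.1) :
    (univ.filter Acc).card ≤ Fintype.card α * (Fintype.card β * ((univ.filter P).card * Fintype.card η)) := by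
  calc (univ.filter Acc).card ≤ ((univ : Finset α) ×ˢ ((univ : Finset β) ×ˢ ((univ.filter P) ×ˢ (univ : Finset η)))).card :=
        card_le_card fun p hp => mem_product.2 ⟨mem_univ _, mem_product.2 ⟨mem_univ _, mem_product.2
          ⟨mem_filter.2 ⟨mem_univ _, h p (mem_filter.1 hp).2⟩, mem_univ _⟩⟩⟩
    _ = _ := by rw [card_product, card_product, card_product, card_univ, card_univ, card_univ]

/-- Fourth coordinate. [folklore] -/
theorem card_filter_le_fth {α β γ η : Type} [Fintype α] [Fintype β] [Fintype γ] [Fintype η]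
    (Acc : α × β × γ × η → Prop) [DecidablePred Acc] (P : η → Prop) [DecidablePred P] (h : ∀ p, Acc p → P p.2.2.2) :
    (univ.filter Acc).card ≤ Fintype.card α * (Fintype.card β * (Fintype.card γ * (univ.filter P).card)) := by
  calc (univ.filter Acc).card ≤ ((univ : Finset α) ×ˢ ((univ : Finset β) ×ˢ ((univ : Finset γ) ×ˢ (univ.filter P)))).card :=
        card_le_card fun p hp => mem_product.2 ⟨mem_univ _, mem_product.2 ⟨mem_univ _, mem_product.2
          ⟨mem_univ _, mem_filter.2 ⟨mem_univ _, h p (mem_filter.1 hp).2⟩⟩⟩⟩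
    _ = _ := by rw [card_product, card_product, card_product, card_univ, card_univ, card_univ]

/-- **Step 2 over `T₂ = 3` independent trials**: if one trial passes with probability `≤ 79/100` then all
three pass with probability `≤ 1/2`. [cite: AroraBarakCC2009, §11.5.2 (Step 2, repetition)] -/
theorem two_mul_card_tensorTrials_le {f : (Fin n → Bool) → Bool} {g : (Fin (n * n) → Bool) → Bool} {u : Fin n → Bool}
    {w : Fin (n * n) → Bool} (hf : IsClose (1 - δ₀) f (dot u)) (hg : IsClose (1 - δ₀) g (dot w)) (hw : w ≠ tensorVec u u) :
    2 * (univ.filter fun c : Fin T₂ → (Fin n → Bool) × (Fin n → Bool) × (Fin (n * n) → Bool) =>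
        ∀ i, tensorPass f g (c i) = true).card ≤
      Fintype.card (Fin T₂ → (Fin n → Bool) × (Fin n → Bool) × (Fin (n * n) → Bool)) := by
  classical
  have h1 := card_tensorPass_le hf hg hw
  rw [card_filter_pi_forall, Fintype.card_fun, Fintype.card_fin, Fintype.card_prod, Fintype.card_prod, card_vec, card_vec]
  set Q : ℝ := 2 ^ n * (2 ^ n * 2 ^ (n * n)) with hQ
  set x : ℝ := ((univ.filter fun q => tensorPass f g q = true).card : ℝ) with hxdef
  have hx0 : 0 ≤ x := by positivity
  have hx : x ≤ 79 / 100 * Q := by rw [δ₀] at h1; linarith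
  have key : 2 * x ^ T₂ ≤ Q ^ T₂ := by
    rw [T₂]
    calc 2 * x ^ 3 ≤ 2 * (79 / 100 * Q) ^ 3 := by gcongr
      _ = (2 * (79 / 100) ^ 3) * Q ^ 3 := by ring
      _ ≤ 1 * Q ^ 3 := mul_le_mul_of_nonneg_right (by norm_num) (by positivity)
      _ = Q ^ 3 := one_mul _
  rw [hxdef, hQ] at key
  exact_mod_cast key

/-- **Step 3 over `T₃ = 2` independent trials**: if one trial passes with probability `≤ 52/100` then both
pass with probability `≤ 1/2`. [cite: AroraBarakCC2009, §11.5.2 (Step 3, repetition)] -/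
theorem two_mul_card_eqTrials_le {A : Fin m → Fin (n * n) → Bool} {b : Fin m → Bool} {g : (Fin (n * n) → Bool) → Bool}
    {w : Fin (n * n) → Bool} (hg : IsClose (1 - δ₀) g (dot w)) (hviol : ∃ k, dot (A k) w ≠ b k) :
    2 * (univ.filter fun c : Fin T₃ → (Fin m → Bool) × (Fin (n * n) → Bool) => ∀ i, eqPass A b g (c i) = true).card ≤
      Fintype.card (Fin T₃ → (Fin m → Bool) × (Fin (n * n) → Bool)) := by
  classical
  have h1 := card_eqPass_le hg hviol
  rw [card_filter_pi_forall, Fintype.card_fun, Fintype.card_fin, Fintype.card_prod, card_vec, card_vec]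
  set Q : ℝ := 2 ^ m * 2 ^ (n * n) with hQ
  set x : ℝ := ((univ.filter fun q => eqPass A b g q = true).card : ℝ) with hxdef
  have hx0 : 0 ≤ x := by positivity
  have hx : x ≤ 52 / 100 * Q := by rw [δ₀] at h1; linarith
  have key : 2 * x ^ T₃ ≤ Q ^ T₃ := by
    rw [T₃]
    calc 2 * x ^ 2 ≤ 2 * (52 / 100 * Q) ^ 2 := by gcongr
      _ = (2 * (52 / 100) ^ 2) * Q ^ 2 := by ring
      _ ≤ 1 * Q ^ 2 := mul_le_mul_of_nonneg_right (by norm_num) (by positivity)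
      _ = Q ^ 2 := one_mul _
  rw [hxdef, hQ] at key
  exact_mod_cast key

/-- **Soundness of the Walsh–Hadamard verifier** (Arora–Barak, Thm. 11.19, proof in §11.5.2): if the
`QUADEQ` instance `(A, b)` is unsatisfiable then every proof `(f, g)` is accepted on at most half of the
coin tuples.  Case analysis as in print: if `f` (or `g`) is not `(1 - δ)`-close to a linear function,
Step 1 rejects (`two_mul_card_blrTrials_le`); otherwise `f ≈ WH(u)`, `g ≈ WH(w)` for unique `u, w`,
and if `w ≠ u ⊗ u` Step 2 rejects (`two_mul_card_tensorTrials_le`), while if `w = u ⊗ u` then `u`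
violates an equation and Step 3 rejects (`two_mul_card_eqTrials_le`).
[cite: AroraBarakCC2009, Thm. 11.19 (proof, §11.5.2)] -/
theorem two_mul_card_accepts_le {A : Fin m → Fin (n * n) → Bool} {b : Fin m → Bool} (hunsat : ∀ u, ¬ Satisfies A b u)
    (f : (Fin n → Bool) → Bool) (g : (Fin (n * n) → Bool) → Bool) :
    2 * (univ.filter fun c => accepts A b f g c = true).card ≤ Fintype.card (Coins n m) := by
  classical
  rw [show Fintype.card (Coins n m) = Fintype.card (Fin T₁ → (Fin n → Bool) × (Fin n → Bool)) *
      (Fintype.card (Fin T₁ → (Fin (n * n) → Bool) × (Fin (n * n) → Bool)) *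
        (Fintype.card (Fin T₂ → (Fin n → Bool) × (Fin n → Bool) × (Fin (n * n) → Bool)) *
          Fintype.card (Fin T₃ → (Fin m → Bool) × (Fin (n * n) → Bool)))) by
    rw [Fintype.card_prod, Fintype.card_prod, Fintype.card_prod]]
  by_cases hfclose : ∃ u, IsClose (1 - δ₀) f (dot u)
  · obtain ⟨u, hu⟩ := hfclose
    by_cases hgclose : ∃ w, IsClose (1 - δ₀) g (dot w)
    · obtain ⟨w, hw⟩ := hgclose
      by_cases hwu : w = tensorVec u u
      · -- (B2): `u` violates an equation; Step 3 rejects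
        have hviol : ∃ k, dot (A k) w ≠ b k := by
          have := hunsat u
          rw [Satisfies] at this
          push Not at this
          rwa [hwu]
        have h3 := two_mul_card_eqTrials_le hw hviol
        have hproj := card_filter_le_fth (fun c => accepts A b f g c = true)
          (fun c4 : Fin T₃ → (Fin m → Bool) × (Fin (n * n) → Bool) => ∀ i, eqPass A b g (c4 i) = true)
          fun c hc => (of_decide_eq_true hc).2.2.2
        calc 2 * (univ.filter fun c => accepts A b f g c = true).card
            ≤ 2 * (Fintype.card (Fin T₁ → (Fin n → Bool) × (Fin n → Bool)) *
                (Fintype.card (Fin T₁ → (Fin (n * n) → Bool) × (Fin (n * n) → Bool)) *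
                  (Fintype.card (Fin T₂ → (Fin n → Bool) × (Fin n → Bool) × (Fin (n * n) → Bool)) *
                    (univ.filter fun c4 : Fin T₃ → (Fin m → Bool) × (Fin (n * n) → Bool) => ∀ i, eqPass A b g (c4 i) = true).card))) :=
              Nat.mul_le_mul_left 2 hproj
          _ = Fintype.card (Fin T₁ → (Fin n → Bool) × (Fin n → Bool)) *
                (Fintype.card (Fin T₁ → (Fin (n * n) → Bool) × (Fin (n * n) → Bool)) *
                  (Fintype.card (Fin T₂ → (Fin n → Bool) × (Fin n → Bool) × (Fin (n * n) → Bool)) *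
                    (2 * (univ.filter fun c4 : Fin T₃ → (Fin m → Bool) × (Fin (n * n) → Bool) => ∀ i, eqPass A b g (c4 i) = true).card))) := by
              ring
          _ ≤ _ := Nat.mul_le_mul_left _ (Nat.mul_le_mul_left _ (Nat.mul_le_mul_left _ h3))
      · -- (B1): `w ≠ u ⊗ u`; Step 2 rejects
        have h2 := two_mul_card_tensorTrials_le hu hw hwu
        have hproj := card_filter_le_thd (fun c => accepts A b f g c = true)
          (fun c3 : Fin T₂ → (Fin n → Bool) × (Fin n → Bool) × (Fin (n * n) → Bool) => ∀ i, tensorPass f g (c3 i) = true)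
          fun c hc => (of_decide_eq_true hc).2.2.1
        calc 2 * (univ.filter fun c => accepts A b f g c = true).card
            ≤ 2 * (Fintype.card (Fin T₁ → (Fin n → Bool) × (Fin n → Bool)) *
                (Fintype.card (Fin T₁ → (Fin (n * n) → Bool) × (Fin (n * n) → Bool)) *
                  ((univ.filter fun c3 : Fin T₂ → (Fin n → Bool) × (Fin n → Bool) × (Fin (n * n) → Bool) => ∀ i, tensorPass f g (c3 i) = true).card *
                    Fintype.card (Fin T₃ → (Fin m → Bool) × (Fin (n * n) → Bool))))) :=
              Nat.mul_le_mul_left 2 hproj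
          _ = Fintype.card (Fin T₁ → (Fin n → Bool) × (Fin n → Bool)) *
                (Fintype.card (Fin T₁ → (Fin (n * n) → Bool) × (Fin (n * n) → Bool)) *
                  ((2 * (univ.filter fun c3 : Fin T₂ → (Fin n → Bool) × (Fin n → Bool) × (Fin (n * n) → Bool) =>
                      ∀ i, tensorPass f g (c3 i) = true).card) *
                    Fintype.card (Fin T₃ → (Fin m → Bool) × (Fin (n * n) → Bool)))) := by
              ring
          _ ≤ _ := Nat.mul_le_mul_left _ (Nat.mul_le_mul_left _ (Nat.mul_le_mul_right _ h2))
    · -- (A, g): Step 1 on `g` rejects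
      push Not at hgclose
      have h1 := two_mul_card_blrTrials_le g hgclose
      have hproj := card_filter_le_snd (fun c => accepts A b f g c = true)
        (fun c2 : Fin T₁ → (Fin (n * n) → Bool) × (Fin (n * n) → Bool) => ∀ i, blrPass g (c2 i) = true)
        fun c hc => (of_decide_eq_true hc).2.1
      calc 2 * (univ.filter fun c => accepts A b f g c = true).card
          ≤ 2 * (Fintype.card (Fin T₁ → (Fin n → Bool) × (Fin n → Bool)) *
              ((univ.filter fun c2 : Fin T₁ → (Fin (n * n) → Bool) × (Fin (n * n) → Bool) => ∀ i, blrPass g (c2 i) = true).card *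
                (Fintype.card (Fin T₂ → (Fin n → Bool) × (Fin n → Bool) × (Fin (n * n) → Bool)) *
                  Fintype.card (Fin T₃ → (Fin m → Bool) × (Fin (n * n) → Bool))))) :=
            Nat.mul_le_mul_left 2 hproj
        _ = Fintype.card (Fin T₁ → (Fin n → Bool) × (Fin n → Bool)) *
              ((2 * (univ.filter fun c2 : Fin T₁ → (Fin (n * n) → Bool) × (Fin (n * n) → Bool) => ∀ i, blrPass g (c2 i) = true).card) *
                (Fintype.card (Fin T₂ → (Fin n → Bool) × (Fin n → Bool) × (Fin (n * n) → Bool)) *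
                  Fintype.card (Fin T₃ → (Fin m → Bool) × (Fin (n * n) → Bool)))) := by
            ring
        _ ≤ _ := Nat.mul_le_mul_left _ (Nat.mul_le_mul_right _ h1)
  · -- (A, f): Step 1 on `f` rejects
    push Not at hfclose
    have h1 := two_mul_card_blrTrials_le f hfclose
    have hproj := card_filter_le_fst (fun c => accepts A b f g c = true)
      (fun c1 : Fin T₁ → (Fin n → Bool) × (Fin n → Bool) => ∀ i, blrPass f (c1 i) = true)
      fun c hc => (of_decide_eq_true hc).1
    calc 2 * (univ.filter fun c => accepts A b f g c = true).card
        ≤ 2 * ((univ.filter fun c1 : Fin T₁ → (Fin n → Bool) × (Fin n → Bool) => ∀ i, blrPass f (c1 i) = true).card *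
            (Fintype.card (Fin T₁ → (Fin (n * n) → Bool) × (Fin (n * n) → Bool)) *
              (Fintype.card (Fin T₂ → (Fin n → Bool) × (Fin n → Bool) × (Fin (n * n) → Bool)) *
                Fintype.card (Fin T₃ → (Fin m → Bool) × (Fin (n * n) → Bool))))) :=
          Nat.mul_le_mul_left 2 hproj
      _ = (2 * (univ.filter fun c1 : Fin T₁ → (Fin n → Bool) × (Fin n → Bool) => ∀ i, blrPass f (c1 i) = true).card) *
            (Fintype.card (Fin T₁ → (Fin (n * n) → Bool) × (Fin (n * n) → Bool)) *
              (Fintype.card (Fin T₂ → (Fin n → Bool) × (Fin n → Bool) × (Fin (n * n) → Bool)) *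
                Fintype.card (Fin T₃ → (Fin m → Bool) × (Fin (n * n) → Bool)))) := by
          ring
      _ ≤ _ := Nat.mul_le_mul_right _ h1

end BLR

end Literature.Computability.Complexity

end
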